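import Summits.Ventures.PercRepro.Night2LocalD3ZeroClosure

/-!
# PercRepro — the regime `|E ∖ G| = q − 1` on COLOOP-FREE flats, every `q`: the counting half (night-2, gen 12)

The `q = 4` modules `Night2LocalD3Zero` / `Night2LocalD3ZeroClosure` / `Night2LocalD3ZeroFat` with the numerals replaced
by `q`: `M` loopless simple, `G` a rank-`(q+1)` flat with `|E ∖ G| = q − 1`, `M|G` without coloops.  With `Φ = (q+2)/(q+1)`:

* no layer-0 member, `capS = 1`; a member outside layer 0 requests `≤ Φ/(q+1)`; a shadow set has `≤ q+1` preimages, so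
  `L1 ≤ Φ`, the served fraction is `≥ 1/Φ`, every loss is `≤ 1/(q+1)²` and `w₂(B, S) ≤ 2/((q+1)²(|G ∖ cl B| − 1))`;
* `cap₂(S) ≥ 1 − a(q+2)/(q+1)²` for `a = #coloops(S)`, and with `2·#ex2 ≤ (q+2−a)(q+1−a)` the columns with `2 ≤ a ≤ q − 1`
  close by the quadratic inequality `a² − (q+1)a + (q+1) ≤ 0` (`load2_le_cap2_dqm1_zero_of_two_le`, `q ≥ 3`); `a = q` has no
  layer-2 weight (simple), `a ≥ q+1` no series pair;
* the structure forced by a loss: `L1 > 1` needs `q + 1` preimages, so the covering set is an independent `(q+1)`-set and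
  `|S| = q + 2` (`card_eq_add_two_of_mem_ex2`); the non-coloops of `S` have `S ∖ t` independent; the coloops of `S` lie in
  every member carrying layer-2 weight; `G ∖ S ≠ ∅`.

The fat-pair count and the cell are in `Night2LocalDQm1ZeroFat.lean`.  Paper: `proofs/NIGHT-2-dq3.md` §6.
-/

open scoped Matroid

namespace PercRepro.Shadow

open Finset PerFlat ThmH

variable {α : Type*} [DecidableEq α] {M : Matroid α} [M.Finite]

section Counting

variable {q : ℕ} {G S : Finset α}

omit [DecidableEq α] [M.Finite] in
/-- `Φ/(2 + (q − 1)) = Φ/(q + 1)`. -/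
theorem phiQ_div_two_add_pred {d : ℕ} (hd : d + 1 = q) : phiQ q / (2 + (d : ℚ)) = phiQ q / ((q : ℚ) + 1) := by
  have : (q : ℚ) = (d : ℚ) + 1 := by exact_mod_cast hd.symm
  rw [this]; ring_nf

omit [DecidableEq α] [M.Finite] in
/-- `(q + 1) · Φ/(q + 1) = Φ`. -/
theorem add_one_mul_phiQ_div (q : ℕ) : ((q : ℚ) + 1) * (phiQ q / ((q : ℚ) + 1)) = phiQ q := by
  have : (0 : ℚ) < (q : ℚ) + 1 := by positivity
  field_simp

omit [DecidableEq α] [M.Finite] in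
/-- `(Φ − 1)/Φ = 1/(q + 2)`. -/
theorem phiQ_sub_one_div (q : ℕ) : (phiQ q - 1) / phiQ q = 1 / ((q : ℚ) + 2) := by
  unfold phiQ
  have h1 : (0 : ℚ) < (q : ℚ) + 1 := by positivity
  have h2 : (0 : ℚ) < (q : ℚ) + 2 := by positivity
  field_simp
  ring

omit [DecidableEq α] [M.Finite] in
/-- `1 ≤ Φ`. -/
theorem one_le_phiQ (q : ℕ) : 1 ≤ phiQ q := by
  unfold phiQ
  have h1 : (0 : ℚ) < (q : ℚ) + 1 := by positivity
  rw [le_div_iff₀ h1]; linarith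

open scoped Classical in
/-- At `d = q − 1` without coloops of `M|G`: `L1 S ≤ Φ` at every shadow set. -/
theorem L1_le_phiQ (hG : G ∈ flatsQ M (q + 1)) {d : ℕ} (hd : (gr M \ G).card = d) (hdq : d + 1 = q)
    (hS : S ∈ shadowAt M (q + 2) q (Uq M (q + 2) q) G) : L1 M q G S ≤ phiQ q := by
  have hL := L1_le_shadow_mul hG hd (by omega) hS
  rw [phiQ_div_two_add_pred hdq, add_one_mul_phiQ_div] at hL
  exact hL

open scoped Classical in
/-- At `d = q − 1` without coloops of `M|G`: `1 − fS S ≤ 1/(q + 2)` at every shadow set. -/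
theorem one_sub_fS_le_dqm1 (hG : G ∈ flatsQ M (q + 1)) {d : ℕ} (hd : (gr M \ G).card = d) (hdq : d + 1 = q)
    (hk : kColoops M G = 0) (hS : S ∈ shadowAt M (q + 2) q (Uq M (q + 2) q) G) :
    1 - fS M q G S ≤ 1 / ((q : ℚ) + 2) := by
  have h := one_sub_fS_le_of_capS_eq_one (capS_eq_one_of_kColoops_eq_zero hk S) (L1_le_phiQ hG hd hdq hS)
    (one_le_phiQ q)
  rw [phiQ_sub_one_div] at h
  exact h

open scoped Classical in
/-- At `d = q − 1` without coloops of `M|G`: every loss is at most `1/(q+1)²`. -/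
theorem loss_le_dqm1_zero (hG : G ∈ flatsQ M (q + 1)) {d : ℕ} (hd : (gr M \ G).card = d) (hdq : d + 1 = q)
    (hk : kColoops M G = 0) {B : Finset α} (hB : B ∈ membersIn M (Uq M (q + 2) q) G) (hB0 : B ∉ lay0 M q G)
    {z : α} (hz : z ∈ G \ clF M B) : loss M q G B z ≤ 1 / (((q : ℚ) + 1) ^ 2) := by
  have hS : insert z B ∈ shadowAt M (q + 2) q (Uq M (q + 2) q) G :=
    insert_mem_shadowAt (Finset.Subset.refl _) hG hB hz
  have h1 := one_sub_fS_le_dqm1 hG hd hdq hk hS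
  have hreq : req M q B ≤ phiQ q / ((q : ℚ) + 1) := by
    have := req_le_of_not_lay0 hG hd (by omega) hB hB0
    rw [phiQ_div_two_add_pred hdq] at this
    exact this
  have hcap : 0 ≤ capS M q G (insert z B) := by
    rw [capS_eq_one_of_kColoops_eq_zero hk]; exact zero_le_one
  have h0 : 0 ≤ 1 - fS M q G (insert z B) := by
    have := fS_le_one hcap
    linarith
  have hq1 : (0 : ℚ) < (q : ℚ) + 1 := by positivity
  have hq2 : (0 : ℚ) < (q : ℚ) + 2 := by positivity
  unfold loss
  calc req M q B * (1 - fS M q G (insert z B)) ≤ (phiQ q / ((q : ℚ) + 1)) * (1 / ((q : ℚ) + 2)) :=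
        mul_le_mul hreq h1 h0 (div_nonneg (phiQ_pos q).le hq1.le)
    _ = 1 / (((q : ℚ) + 1) ^ 2) := by
        unfold phiQ
        field_simp

open scoped Classical in
/-- At `d = q − 1` without coloops of `M|G`: `w₂(B, S) ≤ (2/(q+1)²)/(|G ∖ cl B| − 1)`. -/
theorem w2_le_dqm1_zero (hG : G ∈ flatsQ M (q + 1)) {d : ℕ} (hd : (gr M \ G).card = d) (hdq : d + 1 = q)
    (hk : kColoops M G = 0) {B : Finset α} (hB : B ∈ ex2 M q G S) :
    w2 M q G B S ≤ (2 / (((q : ℚ) + 1) ^ 2)) / (((G \ clF M B).card : ℚ) - 1) := by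
  obtain ⟨hBm, hB0, hBS, hsub, hcard⟩ := mem_ex2_unpack hB
  have hm : 2 ≤ (G \ clF M B).card := hcard ▸ Finset.card_le_card hsub
  have hden : (0 : ℚ) ≤ ((G \ clF M B).card : ℚ) - 1 := by
    have : (2 : ℚ) ≤ ((G \ clF M B).card : ℚ) := by exact_mod_cast hm
    linarith
  have hsum : ∑ z ∈ S \ B, loss M q G B z ≤ 2 / (((q : ℚ) + 1) ^ 2) := by
    calc ∑ z ∈ S \ B, loss M q G B z ≤ ∑ _z ∈ S \ B, (1 : ℚ) / (((q : ℚ) + 1) ^ 2) :=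
          Finset.sum_le_sum (fun z hz => loss_le_dqm1_zero hG hd hdq hk hBm hB0 (hsub hz))
      _ = 2 / (((q : ℚ) + 1) ^ 2) := by rw [Finset.sum_const, hcard, nsmul_eq_mul]; push_cast; ring
  unfold w2
  rw [if_pos ⟨hB0, hBS, hsub, hcard⟩]
  exact div_le_div_of_nonneg_right hsum hden

open scoped Classical in
/-- `w₂(B, S) ≤ 2/(q+1)²`. -/
theorem w2_le_two_div_dqm1_zero (hG : G ∈ flatsQ M (q + 1)) {d : ℕ} (hd : (gr M \ G).card = d) (hdq : d + 1 = q)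
    (hk : kColoops M G = 0) {B : Finset α} (hB : B ∈ ex2 M q G S) :
    w2 M q G B S ≤ 2 / (((q : ℚ) + 1) ^ 2) := by
  refine (w2_le_dqm1_zero hG hd hdq hk hB).trans ?_
  obtain ⟨-, -, -, hsub, hcard⟩ := mem_ex2_unpack hB
  have hm : 2 ≤ (G \ clF M B).card := hcard ▸ Finset.card_le_card hsub
  have : (1 : ℚ) ≤ ((G \ clF M B).card : ℚ) - 1 := by
    have : (2 : ℚ) ≤ ((G \ clF M B).card : ℚ) := by exact_mod_cast hm
    linarith
  have hpos : (0 : ℚ) ≤ 2 / (((q : ℚ) + 1) ^ 2) := by positivity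
  calc (2 / (((q : ℚ) + 1) ^ 2)) / (((G \ clF M B).card : ℚ) - 1) ≤ (2 / (((q : ℚ) + 1) ^ 2)) / 1 :=
        div_le_div_of_nonneg_left hpos (by norm_num) this
    _ = 2 / (((q : ℚ) + 1) ^ 2) := by norm_num

open scoped Classical in
/-- A thin member (`|G ∖ cl B| ≥ 3`) has `w₂(B, S) ≤ 1/(q+1)²`. -/
theorem w2_le_one_div_dqm1_zero (hG : G ∈ flatsQ M (q + 1)) {d : ℕ} (hd : (gr M \ G).card = d) (hdq : d + 1 = q)
    (hk : kColoops M G = 0) {B : Finset α} (hB : B ∈ ex2 M q G S) (hm : 3 ≤ (G \ clF M B).card) :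
    w2 M q G B S ≤ 1 / (((q : ℚ) + 1) ^ 2) := by
  refine (w2_le_dqm1_zero hG hd hdq hk hB).trans ?_
  have : (2 : ℚ) ≤ ((G \ clF M B).card : ℚ) - 1 := by
    have : (3 : ℚ) ≤ ((G \ clF M B).card : ℚ) := by exact_mod_cast hm
    linarith
  have hpos : (0 : ℚ) ≤ 2 / (((q : ℚ) + 1) ^ 2) := by positivity
  calc (2 / (((q : ℚ) + 1) ^ 2)) / (((G \ clF M B).card : ℚ) - 1) ≤ (2 / (((q : ℚ) + 1) ^ 2)) / 2 :=
        div_le_div_of_nonneg_left hpos (by norm_num) this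
    _ = 1 / (((q : ℚ) + 1) ^ 2) := by ring

open scoped Classical in
/-- At `d = q − 1` without coloops of `M|G`: `cap₂(S) ≥ 1 − #coloops(S) · (q+2)/(q+1)²`. -/
theorem cap2_ge_dqm1_zero (hG : G ∈ flatsQ M (q + 1)) {d : ℕ} (hd : (gr M \ G).card = d) (hdq : d + 1 = q)
    (hk : kColoops M G = 0) (S : Finset α) :
    1 - ((coloops M S).card : ℚ) * (((q : ℚ) + 2) / (((q : ℚ) + 1) ^ 2)) ≤ cap2 M q G S := by
  have hcap1 : capS M q G S = 1 := capS_eq_one_of_kColoops_eq_zero hk S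
  have h1 := cap2_ge_capS_sub_L1 (M := M) (q := q) (G := G) (S := S) (by rw [hcap1]; exact zero_le_one)
  rw [hcap1] at h1
  have h2 := L1_le_coloops_mul hG hd (by omega) S
  rw [phiQ_div_two_add_pred hdq] at h2
  have heq : phiQ q / ((q : ℚ) + 1) = ((q : ℚ) + 2) / (((q : ℚ) + 1) ^ 2) := by
    unfold phiQ
    have : (0 : ℚ) < (q : ℚ) + 1 := by positivity
    field_simp
  rw [heq] at h2
  linarith

/-- `cap₂(S) ≥ 0` without coloops of `M|G`. -/
theorem cap2_nonneg_dqm1_zero (hk : kColoops M G = 0) (S : Finset α) : 0 ≤ cap2 M q G S :=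
  cap2_nonneg (by rw [capS_eq_one_of_kColoops_eq_zero hk]; exact zero_le_one)

omit [DecidableEq α] [M.Finite] in
/-- The quadratic inequality of the middle columns: for `2 ≤ a ≤ q − 1` and `3 ≤ q`,
`(q+2−a)(q+1−a) + a(q+2) ≤ (q+1)²`. -/
theorem middle_column_arith {q a : ℕ} (hq : 3 ≤ q) (ha2 : 2 ≤ a) (haq : a + 1 ≤ q) :
    ((q : ℚ) + 2 - (a : ℚ)) * ((q : ℚ) + 1 - (a : ℚ)) + (a : ℚ) * ((q : ℚ) + 2) ≤ ((q : ℚ) + 1) ^ 2 := by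
  have h1 : (2 : ℚ) ≤ (a : ℚ) := by exact_mod_cast ha2
  have h2 : (a : ℚ) + 1 ≤ (q : ℚ) := by exact_mod_cast haq
  have h3 : (3 : ℚ) ≤ (q : ℚ) := by exact_mod_cast hq
  nlinarith [mul_nonneg (sub_nonneg.2 h1) (sub_nonneg.2 h2)]

open scoped Classical in
/-- **The column bound at `d = q − 1`, no coloop of `M|G`, at least two coloops of `S`** (simple `M`, `q ≥ 3`):
`load₂(S) ≤ cap₂(S)`. -/
theorem load2_le_cap2_dqm1_zero_of_two_le (hq : 3 ≤ q) (hs : ∀ e ∈ gr M, ∀ f ∈ gr M, e ≠ f → rkN M {e, f} = 2)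
    (hG : G ∈ flatsQ M (q + 1)) {d : ℕ} (hd : (gr M \ G).card = d) (hdq : d + 1 = q) (hk : kColoops M G = 0)
    (hS : S ∈ shadowAt M (q + 2) q (Uq M (q + 2) q) G) (ha : 2 ≤ (coloops M S).card) :
    load2 M q G S ≤ cap2 M q G S := by
  have hload := load2_le_card_ex2_mul (M := M) (q := q) (G := G) (S := S)
    (fun B hB => w2_le_two_div_dqm1_zero hG hd hdq hk hB)
  have hcap := cap2_ge_dqm1_zero hG hd hdq hk S
  have hcap0 := cap2_nonneg_dqm1_zero (q := q) hk S
  have hex := two_mul_card_ex2_le hG hS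
  obtain ⟨a, ha'⟩ : ∃ a, (coloops M S).card = a := ⟨_, rfl⟩
  rw [ha'] at hex hcap ha
  have hq1 : (0 : ℚ) < ((q : ℚ) + 1) ^ 2 := by positivity
  rcases Nat.lt_or_ge a q with hlt | hge
  · -- `2 ≤ a ≤ q − 1`: the quadratic inequality
    have hexq : (2 * (ex2 M q G S).card : ℚ) ≤ ((q : ℚ) + 2 - (a : ℚ)) * ((q : ℚ) + 1 - (a : ℚ)) := by
      have h : (2 * (ex2 M q G S).card : ℚ) = ((2 * (ex2 M q G S).card : ℕ) : ℚ) := by push_cast; ring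
      rw [h]
      have h2 : ((q + 2 - a) * (q + 1 - a) : ℕ) = ((q : ℚ) + 2 - (a : ℚ)) * ((q : ℚ) + 1 - (a : ℚ)) := by
        rw [Nat.cast_mul, Nat.cast_sub (by omega), Nat.cast_sub (by omega)]; push_cast; ring
      rw [← h2]
      exact_mod_cast hex
    have harith := middle_column_arith hq ha (by omega)
    -- load ≤ #ex2 · 2/(q+1)² ≤ ((q+2−a)(q+1−a))/(q+1)² ≤ 1 − a(q+2)/(q+1)² ≤ cap₂
    have h3 : ((ex2 M q G S).card : ℚ) * (2 / (((q : ℚ) + 1) ^ 2)) ≤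
        1 - (a : ℚ) * (((q : ℚ) + 2) / (((q : ℚ) + 1) ^ 2)) := by
      have hl : ((ex2 M q G S).card : ℚ) * (2 / (((q : ℚ) + 1) ^ 2)) =
          (2 * ((ex2 M q G S).card : ℚ)) / (((q : ℚ) + 1) ^ 2) := by ring
      have hr : 1 - (a : ℚ) * (((q : ℚ) + 2) / (((q : ℚ) + 1) ^ 2)) =
          (((q : ℚ) + 1) ^ 2 - (a : ℚ) * ((q : ℚ) + 2)) / (((q : ℚ) + 1) ^ 2) := by
        field_simp
      rw [hl, hr]
      apply div_le_div_of_nonneg_right _ hq1.le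
      linarith [hexq, harith]
    linarith
  · rcases Nat.lt_or_ge a (q + 1) with heq | hge'
    · -- `a = q`: no layer-2 weight
      have haq : a = q := by omega
      have hempty : ex2 M q G S = ∅ := ex2_eq_empty_of_card_coloops_eq hs hG hS (by rw [ha', haq])
      rw [hempty, Finset.card_empty] at hload
      simp only [Nat.cast_zero, zero_mul] at hload
      exact hload.trans hcap0
    · -- `a ≥ q + 1`: no series pair
      have h0 : (q + 2 - a) * (q + 1 - a) = 0 := by
        have : q + 1 - a = 0 := by omega
        rw [this, mul_zero]
      rw [h0] at hex
      have hcard : (ex2 M q G S).card = 0 := by omega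
      rw [hcard] at hload
      simp only [Nat.cast_zero, zero_mul] at hload
      exact hload.trans hcap0

end Counting

end PercRepro.Shadow
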